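import Mathlib
import Summits.Ventures.PercRepro2.HCov
import Summits.Ventures.PercRepro2.BHKAvoid
import Summits.Ventures.PercRepro2.RootLeafUHalf
import Summits.Ventures.PercRepro2.RootLeafUOu
import Summits.Ventures.PercRepro2.RootLeafUClaimI
import Summits.Ventures.PercRepro2.RootLeafUKMaster
import Summits.Ventures.PercRepro2.RootLeafUKSide

/-!
# The `T′` claim (i′): `t′·A ≥ 2β·P(T′, bK)` for every instance, and the `T′`-association class of the
`o ∈ K` half (blind cell PercRepro2, p4 g28; S3 (G4-u) item (ap), proofs/P4-G28-TPRIME.md)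

Vocabulary of RootLeafUKSide / RootLeafUClaimI (`u = a₁` the root pendant at the unmarked `u`, `c = a₃`):
`Q = {a₂ ↮ u}`, `Z = P(Q)`, `PD`, `T = Q ∩ {c ∈ K}`, `T′ = Q ∩ {c ∈ L}` (`K = C(a₂)`, `L = C(u)`), `D, t, t′` their
masses, `W′ = D + t′ = P(R′)`, `R′ = {a₂ ↮ u, a₂ ↮ c}`, `hb = P(a₂ ↔ b)`, `d0 = P(a₂ ↮ c)`, `gap = hb − P(u ↔ b)`,
`α = D·hb + d0·gap`, `β = D + d0·Z`, `A = κ + α` (the coefficient of `δK` in `K3 = A·δK + 2β·(b)`).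

* **`claim_i'`** (the mirror of `LMaster.claim_i : W·A ≥ 2β·P(R, bK)`): **`t′·A ≥ 2β·P(T′, bK)`**, i.e.
  `Λ := A/(2β) ≥ P(bK | T′)` on every finite graph and every weight vector.  Certificate identity
  (`claim_i'_identity`, a `ring` identity after `Qsplit`, `Qsplit_univ`, `gap_eq_Q`):

  `t′·A − 2β·P(T′,bK) = 2·[ W′·(t′·hb − P(T′,bK)) + t′·P(R′,bL) + d0·(t′·P(Q,bK) − Z·P(T′,bK)) − d0·t′·P(Q,bL) ]`,

  and the signs: the tower bound `P(T′,bK) ≤ t′·hb` (`prob_Tp_bK_le`); BHK06 Thm 1.4 under `Q` for `{a₂ ↔ b}`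
  against `{u ↔ c}` (`Z·P(T′,bK) ≤ t′·P(Q,bK)`, `Tp_bK_mul_Z_le`); and `t′·(P(R′,bL) − d0·P(Q,bL)) ≥ 0` from
  BHK06 Thm 1.4 under `Q` for `{a₂ ↔ c}` against `{u ↔ b}` (`Z·P(T,bL) ≤ t·P(Q,bL)`, `T_bL_mul_Z_le`) and Harris
  (`t ≤ Z·P(a₂ ↔ c)`): `P(a₂ ↮ c | Q, u ↔ b) ≥ P(a₂ ↮ c)`.
* **`K3_nonneg_of_Tp_assoc`**: **`0 ≤ K3` whenever `P(T′,oK)·P(T′,bK) ≤ t′·P(T′,oK,bK)`** — positive association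
  of `{o ∈ K}` and `{b ∈ K}` given `T′` — through the exact identity
  `t′·K3 = δK·(t′·A − 2β·P(T′,bK)) + 2β·W′·(t′·P(T′,oK,bK) − P(T′,oK)·P(T′,bK))` (`Tp_mul_K3_eq`) with
  `δK ≥ 0` (`KMaster.deltaK_nonneg`); hence **`T2oK_nonneg_of_Tp_assoc`** by `KSide.T2oK_nonneg_of_K3`.
  Equivalently `K3 ⟺ P(oK,bK | T′) + Λ·(P(oK | R′) − P(oK | T′)) ≥ P(oK | R′)·P(bK | T′)`, so with `Λ ≥ P(bK | T′)`
  the `o ∈ K` half is open exactly on the instances where `o ∈ K` and `b ∈ K` are NEGATIVELY correlated given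
  `a₂ ↮ u, u ↔ c` (the «two-route» instances), and there by at most `(P(oK|R′) − P(oK|T′))·(Λ − P(bK|T′))`.
-/

namespace Summit.Ventures.PercRepro2

open UnionCluster CovForm

namespace RootLeafU

namespace LMaster

variable {V : Type*} {E : Type*} [Fintype E] [DecidableEq E] [Fintype V] [DecidableEq V]
  {R : Type*} [Field R] [LinearOrder R] [IsStrictOrderedRing R]

variable (p : E → R) (ends : E → Sym2 V) (a₂ c b u : V)

omit [Fintype E] [DecidableEq E] [Fintype V] [DecidableEq V] [LinearOrder R] [IsStrictOrderedRing R] in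
/-- `{a₂ ↔ b} ∩ {u ↔ c} ∩ {a₂ ↮ u} = T′ ∩ {a₂ ↔ b}`. -/
lemma bK_inter_cL_inter_Q_eq_Tp_bK :
    connEvent ends a₂ b ∩ connEvent ends u c ∩ avoidAll ends a₂ {u} =
      TEvent ends a₂ u c ∩ connEvent ends a₂ b := by
  ext ω
  simp only [Set.mem_inter_iff, mem_connEvent, mem_avoidAll, Finset.mem_singleton, forall_eq, TEvent,
    Set.mem_compl_iff]
  constructor
  · rintro ⟨⟨hb, hc⟩, hq⟩
    exact ⟨⟨fun h => hq (conn_symm h), hc⟩, hb⟩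
  · rintro ⟨⟨hq, hc⟩, hb⟩
    exact ⟨⟨hb, hc⟩, fun h => hq (conn_symm h)⟩

omit [Fintype E] [DecidableEq E] [Fintype V] [DecidableEq V] [LinearOrder R] [IsStrictOrderedRing R] in
/-- `{u ↔ c} ∩ {a₂ ↮ u} = T′`. -/
lemma cL_inter_Q_eq_Tp : connEvent ends u c ∩ avoidAll ends a₂ {u} = TEvent ends a₂ u c := by
  ext ω
  simp only [Set.mem_inter_iff, mem_connEvent, mem_avoidAll, Finset.mem_singleton, forall_eq, TEvent,
    Set.mem_compl_iff]
  constructor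
  · rintro ⟨hc, hq⟩
    exact ⟨fun h => hq (conn_symm h), hc⟩
  · rintro ⟨hq, hc⟩
    exact ⟨hc, fun h => hq (conn_symm h)⟩

omit [Fintype E] [DecidableEq E] [Fintype V] [DecidableEq V] [LinearOrder R] [IsStrictOrderedRing R] in
/-- `{a₂ ↔ c} ∩ {u ↔ b} ∩ {a₂ ↮ u} = T ∩ {u ↔ b}`. -/
lemma cK_inter_bL_inter_Q_eq_T_bL :
    connEvent ends a₂ c ∩ connEvent ends u b ∩ avoidAll ends a₂ {u} =
      TEvent ends u a₂ c ∩ connEvent ends u b := by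
  ext ω
  simp only [Set.mem_inter_iff, mem_connEvent, mem_avoidAll, Finset.mem_singleton, forall_eq, TEvent,
    Set.mem_compl_iff]
  tauto

omit [Fintype E] [DecidableEq E] [Fintype V] [DecidableEq V] [LinearOrder R] [IsStrictOrderedRing R] in
/-- `{a₂ ↔ c} ∩ {a₂ ↮ u} = T`. -/
lemma cK_inter_Q_eq_T : connEvent ends a₂ c ∩ avoidAll ends a₂ {u} = TEvent ends u a₂ c := by
  ext ω
  simp only [Set.mem_inter_iff, mem_connEvent, mem_avoidAll, Finset.mem_singleton, forall_eq, TEvent,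
    Set.mem_compl_iff]
  tauto

omit [Fintype E] [DecidableEq E] [Fintype V] [DecidableEq V] [LinearOrder R] [IsStrictOrderedRing R] in
/-- `{a₂ ↮ c} = {a₂ ↔ c}ᶜ`. -/
lemma avoid_c_eq_compl : avoidAll ends a₂ {c} = (connEvent ends a₂ c)ᶜ := by
  ext ω
  simp only [mem_avoidAll, Finset.mem_singleton, forall_eq, Set.mem_compl_iff, mem_connEvent]

omit [Fintype E] [DecidableEq E] [Fintype V] [DecidableEq V] [LinearOrder R] [IsStrictOrderedRing R] in
/-- `T′ ⊆ Q`. -/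
lemma Tp_subset_Q : TEvent ends a₂ u c ⊆ avoidAll ends a₂ {u} := by
  intro ω hω
  rw [mem_avoidAll]
  intro x hx
  rw [Finset.mem_singleton] at hx
  subst hx
  exact fun h => hω.1 (conn_symm h)

omit [DecidableEq V] in
/-- **BHK06 Thm 1.4 under `Q`, `{a₂ ↔ b}` against `{u ↔ c}`**: `P(T′, bK) · Z ≤ P(Q, bK) · t′`. -/
lemma Tp_bK_mul_Z_le (hp : IsProbVec p) :
    prob p (TEvent ends a₂ u c ∩ connEvent ends a₂ b) * prob p (avoidAll ends a₂ {u}) ≤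
      prob p (avoidAll ends a₂ {u} ∩ connEvent ends a₂ b) * prob p (TEvent ends a₂ u c) := by
  classical
  have h := bhk_cross_cluster_avoid p hp ends a₂ u (X := {u}) (Finset.mem_singleton_self u)
    (isUpperSet_mem_setOf b) (isUpperSet_mem_setOf c)
  rw [← connEvent_eq_clusterInEvent ends a₂ b, ← connEvent_eq_clusterInEvent ends u c,
    bK_inter_cL_inter_Q_eq_Tp_bK, Set.inter_comm (connEvent ends a₂ b), cL_inter_Q_eq_Tp] at h
  exact h

omit [DecidableEq V] in
/-- **BHK06 Thm 1.4 under `Q`, `{a₂ ↔ c}` against `{u ↔ b}`**: `P(T, bL) · Z ≤ t · P(Q, bL)`. -/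
lemma T_bL_mul_Z_le (hp : IsProbVec p) :
    prob p (TEvent ends u a₂ c ∩ connEvent ends u b) * prob p (avoidAll ends a₂ {u}) ≤
      prob p (TEvent ends u a₂ c) * prob p (avoidAll ends a₂ {u} ∩ connEvent ends u b) := by
  classical
  have h := bhk_cross_cluster_avoid p hp ends a₂ u (X := {u}) (Finset.mem_singleton_self u)
    (isUpperSet_mem_setOf c) (isUpperSet_mem_setOf b)
  rw [← connEvent_eq_clusterInEvent ends a₂ c, ← connEvent_eq_clusterInEvent ends u b,
    cK_inter_bL_inter_Q_eq_T_bL, cK_inter_Q_eq_T, Set.inter_comm (connEvent ends u b)] at h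
  exact h

omit [Fintype V] [DecidableEq V] in
/-- Harris: `t = P(Q, a₂ ↔ c) ≤ Z · P(a₂ ↔ c)`. -/
lemma T_le_Z_mul (hp : IsProbVec p) :
    prob p (TEvent ends u a₂ c) ≤ prob p (avoidAll ends a₂ {u}) * prob p (connEvent ends a₂ c) := by
  have h := prob_inter_le_prob_mul_prob_of_isLowerSet hp (isLowerSet_avoidAll_finset ends a₂ {u})
    (isUpperSet_connEvent ends a₂ c)
  rw [Set.inter_comm, cK_inter_Q_eq_T] at h
  exact h

omit [DecidableEq V] in
/-- **`t′·(P(R′, bL) − d0·P(Q, bL)) ≥ 0`** (`P(a₂ ↮ c | Q, u ↔ b) ≥ P(a₂ ↮ c)`), in the split masses: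
`0 ≤ t′ · ((1 − d0)·(P(PD,bL) + P(T,bL) + P(T′,bL)) − P(T,bL))`. -/
lemma Tp_mul_RpbL_sub_nonneg (hp : IsProbVec p) :
    0 ≤ prob p (TEvent ends a₂ u c) * ((1 - prob p (avoidAll ends a₂ {c})) * (prob p (PDEvent ends u a₂ c ∩ connEvent ends u b) + prob p (TEvent ends u a₂ c ∩ connEvent ends u b) + prob p (TEvent ends a₂ u c ∩ connEvent ends u b)) - prob p (TEvent ends u a₂ c ∩ connEvent ends u b)) := by
  classical
  have hbL := Qsplit p ends u a₂ c (connEvent ends u b)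
  have hd0 : prob p (avoidAll ends a₂ {c}) = 1 - prob p (connEvent ends a₂ c) := by
    rw [avoid_c_eq_compl, prob_compl]
  have H1 := T_bL_mul_Z_le p ends a₂ c b u hp
  have H2 := T_le_Z_mul p ends a₂ c u hp
  have n_Z := prob_nonneg hp (avoidAll ends a₂ {u})
  have n_tp := prob_nonneg hp (TEvent ends a₂ u c)
  have n_QbL := prob_nonneg hp (avoidAll ends a₂ {u} ∩ connEvent ends u b)
  have hTpZ : prob p (TEvent ends a₂ u c) ≤ prob p (avoidAll ends a₂ {u}) :=
    prob_mono hp (Tp_subset_Q ends a₂ c u)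
  -- `Z · ((1 − d0)·P(Q,bL) − P(T,bL)) ≥ 0`
  have key : 0 ≤ prob p (avoidAll ends a₂ {u}) *
      ((1 - prob p (avoidAll ends a₂ {c})) * prob p (avoidAll ends a₂ {u} ∩ connEvent ends u b) -
        prob p (TEvent ends u a₂ c ∩ connEvent ends u b)) := by
    rw [hd0]
    nlinarith [H1, H2, n_QbL, n_Z]
  rw [← hbL]
  rcases eq_or_lt_of_le n_Z with hZ0 | hZpos
  · have htp0 : prob p (TEvent ends a₂ u c) = 0 := le_antisymm (hZ0 ▸ hTpZ) n_tp
    rw [htp0, zero_mul]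
  · have hX : 0 ≤ (1 - prob p (avoidAll ends a₂ {c})) * prob p (avoidAll ends a₂ {u} ∩ connEvent ends u b) -
        prob p (TEvent ends u a₂ c ∩ connEvent ends u b) :=
      (mul_nonneg_iff_of_pos_left hZpos).mp key
    exact mul_nonneg n_tp hX

omit [Fintype V] in
/-- **The certificate identity of claim (i′)**: `t′·A − 2β·P(T′, bK)` is twice the sum of four terms. -/
theorem claim_i'_identity :
    prob p (TEvent ends a₂ u c) * ((prob p (PDEvent ends u a₂ c) * prob p (connEvent ends a₂ b) + prob p (avoidAll ends a₂ {c}) * gap p ends u a₂ b) + (prob p Set.univ * EQb3 p ends u a₂ c b + prob p Set.univ * PDb p ends u a₂ c b + prob p (connEvent ends a₂ b) * EQ3 p ends u a₂ c + prob p (connEvent ends a₂ b) * prob p (avoidAll ends a₂ {u}) - (prob p Set.univ - prob p (avoidAll ends a₂ {c})) * gap p ends u a₂ b)) - 2 * (prob p Set.univ * prob p (PDEvent ends u a₂ c) + prob p (avoidAll ends a₂ {c}) * prob p (avoidAll ends a₂ {u})) * prob p (TEvent ends a₂ u c ∩ connEvent ends a₂ b) =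
      2 * ((prob p (PDEvent ends u a₂ c) + prob p (TEvent ends a₂ u c)) * (prob p (TEvent ends a₂ u c) * prob p (connEvent ends a₂ b) - prob p (TEvent ends a₂ u c ∩ connEvent ends a₂ b)) + prob p (TEvent ends a₂ u c) * (prob p (PDEvent ends u a₂ c ∩ connEvent ends u b) + prob p (TEvent ends a₂ u c ∩ connEvent ends u b)) + prob p (avoidAll ends a₂ {c}) * (prob p (TEvent ends a₂ u c) * (prob p (PDEvent ends u a₂ c ∩ connEvent ends a₂ b) + prob p (TEvent ends u a₂ c ∩ connEvent ends a₂ b) + prob p (TEvent ends a₂ u c ∩ connEvent ends a₂ b)) - (prob p (PDEvent ends u a₂ c) + prob p (TEvent ends u a₂ c) + prob p (TEvent ends a₂ u c)) * prob p (TEvent ends a₂ u c ∩ connEvent ends a₂ b)) - prob p (avoidAll ends a₂ {c}) * prob p (TEvent ends a₂ u c) * (prob p (PDEvent ends u a₂ c ∩ connEvent ends u b) + prob p (TEvent ends u a₂ c ∩ connEvent ends u b) + prob p (TEvent ends a₂ u c ∩ connEvent ends u b))) := by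
  have hZ := Qsplit_univ p ends u a₂ c
  have hbK := Qsplit p ends u a₂ c (connEvent ends a₂ b)
  have hbL := Qsplit p ends u a₂ c (connEvent ends u b)
  have hgap := gap_eq_Q p ends u a₂ b
  unfold EQb3 PDb EQ3
  rw [hgap, hZ, hbK, hbL, prob_univ]
  ring

/-- **Claim (i′) for every instance**: `0 ≤ t′·A − 2β·P(T′, bK)`, i.e. `Λ = A/(2β) ≥ P(bK | T′)`. -/
theorem claim_i' (hp : IsProbVec p) :
    0 ≤ prob p (TEvent ends a₂ u c) * ((prob p (PDEvent ends u a₂ c) * prob p (connEvent ends a₂ b) + prob p (avoidAll ends a₂ {c}) * gap p ends u a₂ b) + (prob p Set.univ * EQb3 p ends u a₂ c b + prob p Set.univ * PDb p ends u a₂ c b + prob p (connEvent ends a₂ b) * EQ3 p ends u a₂ c + prob p (connEvent ends a₂ b) * prob p (avoidAll ends a₂ {u}) - (prob p Set.univ - prob p (avoidAll ends a₂ {c})) * gap p ends u a₂ b)) - 2 * (prob p Set.univ * prob p (PDEvent ends u a₂ c) + prob p (avoidAll ends a₂ {c}) * prob p (avoidAll ends a₂ {u})) * prob p (TEvent ends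 a₂ u c ∩ connEvent ends a₂ b) := by
  classical
  rw [claim_i'_identity]
  have hZ := Qsplit_univ p ends u a₂ c
  have hbK := Qsplit p ends u a₂ c (connEvent ends a₂ b)
  -- (g1) the tower bound `P(T′,bK) ≤ t′·hb`, times `W′ ≥ 0`
  have H7 := prob_Tp_bK_le p ends a₂ c b u hp
  have n_D := prob_nonneg hp (PDEvent ends u a₂ c)
  have n_tp := prob_nonneg hp (TEvent ends a₂ u c)
  have n_d0 := prob_nonneg hp (avoidAll ends a₂ {c})
  have g1 : 0 ≤ (prob p (PDEvent ends u a₂ c) + prob p (TEvent ends a₂ u c)) * (prob p (TEvent ends a₂ u c) * prob p (connEvent ends a₂ b) - prob p (TEvent ends a₂ u c ∩ connEvent ends a₂ b)) := mul_nonneg (by linarith) (by linarith)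
  -- (g2) BHK06 1.4 under `Q`: `Z·P(T′,bK) ≤ t′·P(Q,bK)`, times `d0 ≥ 0`
  have H8 := Tp_bK_mul_Z_le p ends a₂ c b u hp
  rw [hZ, hbK] at H8
  have g2 : 0 ≤ prob p (avoidAll ends a₂ {c}) * (prob p (TEvent ends a₂ u c) * (prob p (PDEvent ends u a₂ c ∩ connEvent ends a₂ b) + prob p (TEvent ends u a₂ c ∩ connEvent ends a₂ b) + prob p (TEvent ends a₂ u c ∩ connEvent ends a₂ b)) - (prob p (PDEvent ends u a₂ c) + prob p (TEvent ends u a₂ c) + prob p (TEvent ends a₂ u c)) * prob p (TEvent ends a₂ u c ∩ connEvent ends a₂ b)) := mul_nonneg n_d0 (by linarith)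
  -- (g3) `t′·(P(R′,bL) − d0·P(Q,bL)) ≥ 0`
  have g3 := Tp_mul_RpbL_sub_nonneg p ends a₂ c b u hp
  linarith

end LMaster

namespace KSide

variable {V : Type*} {E : Type*} [Fintype E] [DecidableEq E] [Fintype V] [DecidableEq V]
  {R : Type*} [Field R] [LinearOrder R] [IsStrictOrderedRing R]

variable (p : E → R) (ends : E → Sym2 V) (o a₂ c b u : V)

omit [DecidableEq V] [Fintype V] [LinearOrder R] [IsStrictOrderedRing R] in
/-- **`t′·K3 = δK·(t′·A − 2β·P(T′,bK)) + 2β·W′·(t′·P(T′,oK,bK) − P(T′,oK)·P(T′,bK))`** (a `ring` identity). -/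
theorem Tp_mul_K3_eq :
    prob p (TEvent ends a₂ u c) * (((prob p (PDEvent ends u a₂ c) * prob p (connEvent ends a₂ b) + prob p (avoidAll ends a₂ {c}) * gap p ends u a₂ b) + (prob p Set.univ * EQb3 p ends u a₂ c b + prob p Set.univ * PDb p ends u a₂ c b + prob p (connEvent ends a₂ b) * EQ3 p ends u a₂ c + prob p (connEvent ends a₂ b) * prob p (avoidAll ends a₂ {u}) - (prob p Set.univ - prob p (avoidAll ends a₂ {c})) * gap p ends u a₂ b)) * (prob p (TEvent ends a₂ u c) * prob p (PDEvent ends u a₂ c ∩ connEvent ends a₂ o) - prob p (PDEvent ends u a₂ c) * prob p (TEvent ends a₂ u c ∩ connEvent ends a₂ o)) + 2 * (prob p Set.univ * prob p (PDEvent ends u a₂ c) + prob p (avoidAll ends a₂ {c}) * prob p (avoidAll ends a₂ {u})) * ((prob p (PDEvent ends u a₂ c) + prob p (TEvent ends a₂ u c)) * prob p (TEvent ends a₂ u c ∩ (connEvent ends a₂ o ∩ connEvent ends a₂ b)) - (prob p (PDEvent ends u a₂ c ∩ connEvent ends a₂ o) + prob p (TEvent ends a₂ u c ∩ connEvent ends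 a₂ o)) * prob p (TEvent ends a₂ u c ∩ connEvent ends a₂ b))) =
      (prob p (TEvent ends a₂ u c) * prob p (PDEvent ends u a₂ c ∩ connEvent ends a₂ o) - prob p (PDEvent ends u a₂ c) * prob p (TEvent ends a₂ u c ∩ connEvent ends a₂ o)) * (prob p (TEvent ends a₂ u c) * ((prob p (PDEvent ends u a₂ c) * prob p (connEvent ends a₂ b) + prob p (avoidAll ends a₂ {c}) * gap p ends u a₂ b) + (prob p Set.univ * EQb3 p ends u a₂ c b + prob p Set.univ * PDb p ends u a₂ c b + prob p (connEvent ends a₂ b) * EQ3 p ends u a₂ c + prob p (connEvent ends a₂ b) * prob p (avoidAll ends a₂ {u}) - (prob p Set.univ - prob p (avoidAll ends a₂ {c})) * gap p ends u a₂ b)) - 2 * (prob p Set.univ * prob p (PDEvent ends u a₂ c) + prob p (avoidAll ends a₂ {c}) * prob p (avoidAll ends a₂ {u})) * prob p (TEvent ends a₂ u c ∩ connEvent ends a₂ b)) + 2 * (prob p Set.univ * prob p (PDEvent ends u a₂ c) + prob p (avoidAll ends a₂ {c}) * prob p (avoidAll ends a₂ {u})) * (prob p (PDEvent ends u a₂ c)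 + prob p (TEvent ends a₂ u c)) * (prob p (TEvent ends a₂ u c) * prob p (TEvent ends a₂ u c ∩ (connEvent ends a₂ o ∩ connEvent ends a₂ b)) - prob p (TEvent ends a₂ u c ∩ connEvent ends a₂ o) * prob p (TEvent ends a₂ u c ∩ connEvent ends a₂ b)) := by
  ring

omit [Fintype V] [DecidableEq V] in
/-- A `T′`-mass vanishes when `t′ = 0`. -/
lemma prob_Tp_inter_eq_zero (hp : IsProbVec p) (h : prob p (TEvent ends a₂ u c) = 0) (X : Set (Config E)) :
    prob p (TEvent ends a₂ u c ∩ X) = 0 :=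
  le_antisymm (h ▸ prob_mono hp Set.inter_subset_left) (prob_nonneg hp _)

/-- **The `T′`-association class of the `o ∈ K` half**: `0 ≤ K3` whenever `{o ∈ K}` and `{b ∈ K}` are
positively associated given `T′ = {a₂ ↮ u, u ↔ c}`, i.e. `P(T′,oK)·P(T′,bK) ≤ t′·P(T′,oK,bK)`. -/
theorem K3_nonneg_of_Tp_assoc (hp : IsProbVec p)
    (hassoc : prob p (TEvent ends a₂ u c ∩ connEvent ends a₂ o) * prob p (TEvent ends a₂ u c ∩ connEvent ends a₂ b) ≤ prob p (TEvent ends a₂ u c) * prob p (TEvent ends a₂ u c ∩ (connEvent ends a₂ o ∩ connEvent ends a₂ b))) :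
    0 ≤ (((prob p (PDEvent ends u a₂ c) * prob p (connEvent ends a₂ b) + prob p (avoidAll ends a₂ {c}) * gap p ends u a₂ b) + (prob p Set.univ * EQb3 p ends u a₂ c b + prob p Set.univ * PDb p ends u a₂ c b + prob p (connEvent ends a₂ b) * EQ3 p ends u a₂ c + prob p (connEvent ends a₂ b) * prob p (avoidAll ends a₂ {u}) - (prob p Set.univ - prob p (avoidAll ends a₂ {c})) * gap p ends u a₂ b)) * (prob p (TEvent ends a₂ u c) * prob p (PDEvent ends u a₂ c ∩ connEvent ends a₂ o) - prob p (PDEvent ends u a₂ c) * prob p (TEvent ends a₂ u c ∩ connEvent ends a₂ o)) + 2 * (prob p Set.univ * prob p (PDEvent ends u a₂ c) + prob p (avoidAll ends a₂ {c}) * prob p (avoidAll ends a₂ {u})) * ((prob p (PDEvent ends u a₂ c) + prob p (TEvent ends a₂ u c)) * prob p (TEvent ends a₂ u c ∩ (connEvent ends a₂ o ∩ connEvent ends a₂ b)) - (prob p (PDEvent ends u a₂ c ∩ connEvent ends a₂ o) + prob p (TEvent ends a₂ u c ∩ connEvent ends a₂ o)) * prob p (TEvent ends a₂ u c ∩ connEvent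 ends a₂ b))) := by
  classical
  have hid := Tp_mul_K3_eq p ends o a₂ c b u
  have hdK := KMaster.deltaK_nonneg p ends o a₂ c u hp
  have hi' := LMaster.claim_i' p ends a₂ c b u hp
  have n_tp := prob_nonneg hp (TEvent ends a₂ u c)
  have n_D := prob_nonneg hp (PDEvent ends u a₂ c)
  have n_d0 := prob_nonneg hp (avoidAll ends a₂ {c})
  have n_Z := prob_nonneg hp (avoidAll ends a₂ {u})
  have n_β : 0 ≤ (prob p Set.univ * prob p (PDEvent ends u a₂ c) + prob p (avoidAll ends a₂ {c}) * prob p (avoidAll ends a₂ {u})) := by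
    rw [prob_univ]; nlinarith [n_D, n_d0, n_Z]
  have hW : 0 ≤ prob p (PDEvent ends u a₂ c) + prob p (TEvent ends a₂ u c) := add_nonneg n_D n_tp
  have hassoc' : 0 ≤ (prob p (TEvent ends a₂ u c) * prob p (TEvent ends a₂ u c ∩ (connEvent ends a₂ o ∩ connEvent ends a₂ b)) - prob p (TEvent ends a₂ u c ∩ connEvent ends a₂ o) * prob p (TEvent ends a₂ u c ∩ connEvent ends a₂ b)) := by linarith
  have key : 0 ≤ (prob p (TEvent ends a₂ u c) * prob p (PDEvent ends u a₂ c ∩ connEvent ends a₂ o) - prob p (PDEvent ends u a₂ c) * prob p (TEvent ends a₂ u c ∩ connEvent ends a₂ o)) * (prob p (TEvent ends a₂ u c) * ((prob p (PDEvent ends u a₂ c) * prob p (connEvent ends a₂ b) + prob p (avoidAll ends a₂ {c}) * gap p ends u a₂ b) + (prob p Set.univ * EQb3 p ends u a₂ c b + prob p Set.univ * PDb p ends u a₂ c b + prob p (connEvent ends a₂ b) * EQ3 p ends u a₂ c + prob p (connEvent ends a₂ b) * prob p (avoidAll ends a₂ {u}) - (prob p Set.univ - prob p (avoidAll ends a₂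 {c})) * gap p ends u a₂ b)) - 2 * (prob p Set.univ * prob p (PDEvent ends u a₂ c) + prob p (avoidAll ends a₂ {c}) * prob p (avoidAll ends a₂ {u})) * prob p (TEvent ends a₂ u c ∩ connEvent ends a₂ b)) + 2 * (prob p Set.univ * prob p (PDEvent ends u a₂ c) + prob p (avoidAll ends a₂ {c}) * prob p (avoidAll ends a₂ {u})) * (prob p (PDEvent ends u a₂ c) + prob p (TEvent ends a₂ u c)) * (prob p (TEvent ends a₂ u c) * prob p (TEvent ends a₂ u c ∩ (connEvent ends a₂ o ∩ connEvent ends a₂ b)) - prob p (TEvent ends a₂ u c ∩ connEvent ends a₂ o) * prob p (TEvent ends a₂ u c ∩ connEvent ends a₂ b)) :=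
    add_nonneg (mul_nonneg hdK hi') (mul_nonneg (mul_nonneg (mul_nonneg (by norm_num) n_β) hW) hassoc')
  rw [← hid] at key
  rcases eq_or_lt_of_le n_tp with h0 | hpos
  · have e1 := prob_Tp_inter_eq_zero p ends a₂ c u hp h0.symm (connEvent ends a₂ o)
    have e2 := prob_Tp_inter_eq_zero p ends a₂ c u hp h0.symm (connEvent ends a₂ b)
    have e3 := prob_Tp_inter_eq_zero p ends a₂ c u hp h0.symm (connEvent ends a₂ o ∩ connEvent ends a₂ b)
    rw [← h0, e1, e2, e3]
    simp
  · exact (mul_nonneg_iff_of_pos_left hpos).mp key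

/-- **`0 ≤ T2oK` on the `T′`-association class**: positive association of `{o ∈ K}` and `{b ∈ K}` given `T′`
gives the `o ∈ K` half of the second root-leaf coefficient. -/
theorem T2oK_nonneg_of_Tp_assoc (hp : IsProbVec p)
    (hassoc : prob p (TEvent ends a₂ u c ∩ connEvent ends a₂ o) * prob p (TEvent ends a₂ u c ∩ connEvent ends a₂ b) ≤ prob p (TEvent ends a₂ u c) * prob p (TEvent ends a₂ u c ∩ (connEvent ends a₂ o ∩ connEvent ends a₂ b))) :
    0 ≤ T2oK p ends o a₂ c b u :=
  T2oK_nonneg_of_K3 p ends o a₂ c b u hp (K3_nonneg_of_Tp_assoc p ends o a₂ c b u hp hassoc)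

end KSide


namespace KSide

variable {V : Type*} {E : Type*} [Fintype E] [DecidableEq E] [Fintype V] [DecidableEq V]
  {R : Type*} [Field R] [LinearOrder R] [IsStrictOrderedRing R]

variable (p : E → R) (ends : E → Sym2 V) (o a₂ c b u : V)

/-- **The `T′, oK`-level class** (p4 g28, appended): `0 ≤ K3` whenever `A·P(T′,oK) ≤ 2β·P(T′,oK,bK)`, i.e.
`Λ ≤ P(bK | T′, oK)` — the second class that claim (i′) gives: `K3 = [2β·W′·P(T′,oK,bK) − A·W′·P(T′,oK)] +
P(R′,oK)·(t′·A − 2β·P(T′,bK))` (a `ring` identity with `δK + W′·P(T′,oK) = t′·P(R′,oK)`). -/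
theorem K3_nonneg_of_Lam_le_yTo (hp : IsProbVec p) (hyp : ((prob p (PDEvent ends u a₂ c) * prob p (connEvent ends a₂ b) + prob p (avoidAll ends a₂ {c}) * gap p ends u a₂ b) + (prob p Set.univ * EQb3 p ends u a₂ c b + prob p Set.univ * PDb p ends u a₂ c b + prob p (connEvent ends a₂ b) * EQ3 p ends u a₂ c + prob p (connEvent ends a₂ b) * prob p (avoidAll ends a₂ {u}) - (prob p Set.univ - prob p (avoidAll ends a₂ {c})) * gap p ends u a₂ b)) * prob p (TEvent ends a₂ u c ∩ connEvent ends a₂ o) ≤ 2 * (prob p Set.univ * prob p (PDEvent ends u a₂ c) + prob p (avoidAll ends a₂ {c}) * prob p (avoidAll ends a₂ {u})) * prob p (TEvent ends a₂ u c ∩ (connEvent ends a₂ o ∩ connEvent ends a₂ b))) :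
    0 ≤ (((prob p (PDEvent ends u a₂ c) * prob p (connEvent ends a₂ b) + prob p (avoidAll ends a₂ {c}) * gap p ends u a₂ b) + (prob p Set.univ * EQb3 p ends u a₂ c b + prob p Set.univ * PDb p ends u a₂ c b + prob p (connEvent ends a₂ b) * EQ3 p ends u a₂ c + prob p (connEvent ends a₂ b) * prob p (avoidAll ends a₂ {u}) - (prob p Set.univ - prob p (avoidAll ends a₂ {c})) * gap p ends u a₂ b)) * (prob p (TEvent ends a₂ u c) * prob p (PDEvent ends u a₂ c ∩ connEvent ends a₂ o) - prob p (PDEvent ends u a₂ c) * prob p (TEvent ends a₂ u c ∩ connEvent ends a₂ o)) + 2 * (prob p Set.univ * prob p (PDEvent ends u a₂ c) + prob p (avoidAll ends a₂ {c}) * prob p (avoidAll ends a₂ {u})) * ((prob p (PDEvent ends u a₂ c) + prob p (TEvent ends a₂ u c)) * prob p (TEvent ends a₂ u c ∩ (connEvent ends a₂ o ∩ connEvent ends a₂ b)) - (prob p (PDEvent ends u a₂ c ∩ connEvent ends a₂ o) + prob p (TEvent ends a₂ u c ∩ connEvent ends a₂ o)) * prob p (TEvent ends a₂ u c ∩ connEvent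 ends a₂ b))) := by
  classical
  have hi' := LMaster.claim_i' p ends a₂ c b u hp
  have n_W : 0 ≤ prob p (PDEvent ends u a₂ c) + prob p (TEvent ends a₂ u c) :=
    add_nonneg (prob_nonneg hp _) (prob_nonneg hp _)
  have n_RoK : 0 ≤ prob p (PDEvent ends u a₂ c ∩ connEvent ends a₂ o) + prob p (TEvent ends a₂ u c ∩ connEvent ends a₂ o) :=
    add_nonneg (prob_nonneg hp _) (prob_nonneg hp _)
  have h1 := mul_le_mul_of_nonneg_left hyp n_W
  have h2 := mul_nonneg n_RoK hi'
  nlinarith [h1, h2]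

/-- **`0 ≤ T2oK` on the `T′, oK`-level class.** -/
theorem T2oK_nonneg_of_Lam_le_yTo (hp : IsProbVec p) (hyp : ((prob p (PDEvent ends u a₂ c) * prob p (connEvent ends a₂ b) + prob p (avoidAll ends a₂ {c}) * gap p ends u a₂ b) + (prob p Set.univ * EQb3 p ends u a₂ c b + prob p Set.univ * PDb p ends u a₂ c b + prob p (connEvent ends a₂ b) * EQ3 p ends u a₂ c + prob p (connEvent ends a₂ b) * prob p (avoidAll ends a₂ {u}) - (prob p Set.univ - prob p (avoidAll ends a₂ {c})) * gap p ends u a₂ b)) * prob p (TEvent ends a₂ u c ∩ connEvent ends a₂ o) ≤ 2 * (prob p Set.univ * prob p (PDEvent ends u a₂ c) + prob p (avoidAll ends a₂ {c}) * prob p (avoidAll ends a₂ {u})) * prob p (TEvent ends a₂ u c ∩ (connEvent ends a₂ o ∩ connEvent ends a₂ b))) :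
    0 ≤ T2oK p ends o a₂ c b u :=
  T2oK_nonneg_of_K3 p ends o a₂ c b u hp (K3_nonneg_of_Lam_le_yTo p ends o a₂ c b u hp hyp)

end KSide

end RootLeafU

end Summit.Ventures.PercRepro2
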